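import Literature.MathematicalPhysics.QuantumFieldTheory.UnitaryCayleyChart
import HarnessLib

/-!
# The exponential map on a Banach algebra and on `𝔲(N)`: Lipschitz bounds (Chatterjee Lemma 11.2)

Crux `FreeEnergyLogCoefficient` of route `EquipartitionCriticality` (`QuantumFields/YangMills`), line
`Sketch`, stub `stub_expChartPackage` (the exponential chart of a compact matrix group), first file.

For `X, Y` in a complete normed `ℝ`-algebra with `‖X‖, ‖Y‖ ≤ r`:
* `norm_pow_succ_sub_pow_succ_le` : `‖X^{n+1} − Y^{n+1}‖ ≤ (n+1) rⁿ ‖X − Y‖` (telescoping);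
* `norm_exp_sub_exp_sub_le` : `‖(e^X − e^Y) − (X − Y)‖ ≤ (e^r − 1) ‖X − Y‖` (power series), whence the
  two-sided Lipschitz bounds of S. Chatterjee, *The leading term of the Yang–Mills free energy*,
  J. Funct. Anal. 271 (2016), arXiv:1602.01222, Lemma 11.2: `(2 − e^r)‖X − Y‖ ≤ ‖e^X − e^Y‖ ≤ e^r ‖X − Y‖`
  (`sub_mul_norm_sub_le_norm_exp_sub_exp`, `norm_exp_sub_exp_le_exp_mul`);
* for SKEW-HERMITIAN matrices in the Frobenius norm the sharp form `‖e^X − e^Y‖_F ≤ ‖X − Y‖_F`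
  (`norm_exp_sub_exp_le_of_skew`): `e^X = (e^{X/m})^m` with unitary factors, `‖A^m − B^m‖ ≤ m‖A − B‖` for
  unitary `A, B` (unitary invariance of the Frobenius norm), and `m → ∞` in the crude bound at radius `r/m`.

No definitions; everything is proved.
-/

noncomputable section

open scoped Matrix Matrix.Norms.Frobenius Topology
open NormedSpace Filter

namespace Summit.QuantumFields.YangMills.Theorems.FreeEnergyLogCoefficient

-- BODY START
/-! ### Power series estimates in a complete normed algebra -/

section Banach

variable {𝔸 : Type*} [NormedRing 𝔸] [NormedAlgebra ℝ 𝔸] [CompleteSpace 𝔸]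

omit [NormedAlgebra ℝ 𝔸] [CompleteSpace 𝔸] in
/-- Telescoping bound for differences of powers: `‖X^{n+1} − Y^{n+1}‖ ≤ (n+1) rⁿ ‖X − Y‖` when
`‖X‖, ‖Y‖ ≤ r` (no norm-one hypothesis on the algebra is needed). [folklore] -/
theorem norm_pow_succ_sub_pow_succ_le {X Y : 𝔸} {r : ℝ} (hX : ‖X‖ ≤ r) (hY : ‖Y‖ ≤ r) :
    ∀ n : ℕ, ‖X ^ (n + 1) - Y ^ (n + 1)‖ ≤ (n + 1) * r ^ n * ‖X - Y‖
  | 0 => by simp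
  | n + 1 => by
    have hr : 0 ≤ r := (norm_nonneg X).trans hX
    have ih := norm_pow_succ_sub_pow_succ_le hX hY n
    have hsplit : X ^ (n + 1 + 1) - Y ^ (n + 1 + 1) =
        X * (X ^ (n + 1) - Y ^ (n + 1)) + (X - Y) * Y ^ (n + 1) := by
      simp only [pow_succ', mul_sub, sub_mul]; abel
    have h1 : ‖X * (X ^ (n + 1) - Y ^ (n + 1))‖ ≤ r * ((n + 1) * r ^ n * ‖X - Y‖) :=
      (norm_mul_le _ _).trans (mul_le_mul hX ih (norm_nonneg _) hr)
    have h2 : ‖(X - Y) * Y ^ (n + 1)‖ ≤ ‖X - Y‖ * r ^ (n + 1) := by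
      refine (norm_mul_le _ _).trans (mul_le_mul_of_nonneg_left ?_ (norm_nonneg _))
      exact (norm_pow_le' Y n.succ_pos).trans (pow_le_pow_left₀ (norm_nonneg Y) hY _)
    calc ‖X ^ (n + 1 + 1) - Y ^ (n + 1 + 1)‖
        ≤ ‖X * (X ^ (n + 1) - Y ^ (n + 1))‖ + ‖(X - Y) * Y ^ (n + 1)‖ := by
          rw [hsplit]; exact norm_add_le _ _
      _ ≤ r * ((n + 1) * r ^ n * ‖X - Y‖) + ‖X - Y‖ * r ^ (n + 1) := add_le_add h1 h2
      _ = ((n + 1 : ℕ) + 1) * r ^ (n + 1) * ‖X - Y‖ := by push_cast; ring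

/-- The exponential series tail: `Σ_{n ≥ 0} r^{n+1}/(n+1)! = e^r − 1`. [folklore] -/
theorem tsum_pow_succ_div_factorial_succ (r : ℝ) :
    ∑' n : ℕ, r ^ (n + 1) / ((n + 1).factorial : ℝ) = Real.exp r - 1 := by
  have hs := Real.summable_pow_div_factorial r
  have h := hs.tsum_eq_zero_add
  have hexp : Real.exp r = ∑' n : ℕ, r ^ n / (n.factorial : ℝ) := by
    rw [Real.exp_eq_exp_ℝ]; exact congrFun NormedSpace.exp_eq_tsum_div r
  rw [hexp, h]
  simp

/-- **Second-order closeness of `exp` to the identity near `0`**: for `‖X‖, ‖Y‖ ≤ r`,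
`‖(e^X − e^Y) − (X − Y)‖ ≤ (e^r − 1) ‖X − Y‖` (the terms of degree `≥ 2` of the exponential series,
estimated by `norm_pow_succ_sub_pow_succ_le`). [cite: arXiv160201222, Lemma 11.2 (proof)] -/
theorem norm_exp_sub_exp_sub_le {X Y : 𝔸} {r : ℝ} (hX : ‖X‖ ≤ r) (hY : ‖Y‖ ≤ r) :
    ‖(exp X - exp Y) - (X - Y)‖ ≤ (Real.exp r - 1) * ‖X - Y‖ := by
  have hr : 0 ≤ r := (norm_nonneg X).trans hX
  -- the series
  set f : ℕ → 𝔸 := fun n => ((n.factorial : ℝ)⁻¹) • (X ^ n - Y ^ n) with hf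
  have hfX : Summable fun n : ℕ => ((n.factorial : ℝ)⁻¹) • X ^ n := expSeries_summable' (𝕂 := ℝ) X
  have hfY : Summable fun n : ℕ => ((n.factorial : ℝ)⁻¹) • Y ^ n := expSeries_summable' (𝕂 := ℝ) Y
  have hfs : Summable f := by
    have := hfX.sub hfY
    simpa [hf, smul_sub] using this
  have hexp : exp X - exp Y = ∑' n, f n := by
    rw [congrFun (exp_eq_tsum ℝ) X, congrFun (exp_eq_tsum ℝ) Y, ← hfX.tsum_sub hfY]
    exact tsum_congr fun n => by simp [hf, smul_sub]
  -- split off the terms of degree `0` and `1`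
  have hsplit : ∑' n, f n = f 0 + f 1 + ∑' n, f (n + 2) := by
    have h := (hfs.sum_add_tsum_nat_add 2).symm
    rw [Finset.sum_range_succ, Finset.sum_range_one] at h
    exact h
  have hf0 : f 0 = 0 := by simp [hf]
  have hf1 : f 1 = X - Y := by simp [hf]
  have hdiff : (exp X - exp Y) - (X - Y) = ∑' n, f (n + 2) := by
    rw [hexp, hsplit, hf0, hf1]; abel
  -- the majorant
  set g : ℕ → ℝ := fun n => r ^ (n + 1) / ((n + 1).factorial : ℝ) * ‖X - Y‖ with hg
  have hg_summ : Summable g := by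
    have h1 : Summable fun n : ℕ => r ^ (n + 1) / ((n + 1).factorial : ℝ) :=
      (summable_nat_add_iff 1).2 (Real.summable_pow_div_factorial r)
    exact h1.mul_right _
  have hle : ∀ n, ‖f (n + 2)‖ ≤ g n := by
    intro n
    have hfact : 0 < ((n + 2).factorial : ℝ) := by positivity
    have hp := norm_pow_succ_sub_pow_succ_le hX hY (n + 1)
    calc ‖f (n + 2)‖ = ((n + 2).factorial : ℝ)⁻¹ * ‖X ^ (n + 2) - Y ^ (n + 2)‖ := by
          rw [hf]; dsimp only; rw [norm_smul, norm_inv, Real.norm_natCast]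
      _ ≤ ((n + 2).factorial : ℝ)⁻¹ * (((n + 1 : ℕ) + 1) * r ^ (n + 1) * ‖X - Y‖) :=
          mul_le_mul_of_nonneg_left hp (by positivity)
      _ = g n := by
          rw [hg]; dsimp only
          rw [Nat.factorial_succ (n + 1)]
          push_cast
          field_simp
  have hnorm_summ : Summable fun n => ‖f (n + 2)‖ :=
    Summable.of_nonneg_of_le (fun _ => norm_nonneg _) hle hg_summ
  calc ‖(exp X - exp Y) - (X - Y)‖ = ‖∑' n, f (n + 2)‖ := by rw [hdiff]
    _ ≤ ∑' n, ‖f (n + 2)‖ := norm_tsum_le_tsum_norm hnorm_summ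
    _ ≤ ∑' n, g n := hnorm_summ.tsum_le_tsum hle hg_summ
    _ = (Real.exp r - 1) * ‖X - Y‖ := by
        rw [hg, tsum_mul_right, tsum_pow_succ_div_factorial_succ]

/-- **Chatterjee's Lemma 11.2, upper bound**: `‖e^X − e^Y‖ ≤ e^r ‖X − Y‖` for `‖X‖, ‖Y‖ ≤ r`. [cite: arXiv160201222, Lemma 11.2] -/
theorem norm_exp_sub_exp_le_exp_mul {X Y : 𝔸} {r : ℝ} (hX : ‖X‖ ≤ r) (hY : ‖Y‖ ≤ r) :
    ‖exp X - exp Y‖ ≤ Real.exp r * ‖X - Y‖ := by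
  have h := norm_exp_sub_exp_sub_le hX hY
  have h2 : ‖exp X - exp Y‖ ≤ ‖(exp X - exp Y) - (X - Y)‖ + ‖X - Y‖ := by
    have := norm_add_le ((exp X - exp Y) - (X - Y)) (X - Y)
    rwa [sub_add_cancel] at this
  nlinarith [norm_nonneg (X - Y)]

/-- **Chatterjee's Lemma 11.2, lower bound**: `(2 − e^r) ‖X − Y‖ ≤ ‖e^X − e^Y‖` for `‖X‖, ‖Y‖ ≤ r`. [cite: arXiv160201222, Lemma 11.2] -/
theorem sub_mul_norm_sub_le_norm_exp_sub_exp {X Y : 𝔸} {r : ℝ} (hX : ‖X‖ ≤ r) (hY : ‖Y‖ ≤ r) :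
    (2 - Real.exp r) * ‖X - Y‖ ≤ ‖exp X - exp Y‖ := by
  have h := norm_exp_sub_exp_sub_le hX hY
  have h2 : ‖X - Y‖ ≤ ‖(exp X - exp Y) - (X - Y)‖ + ‖exp X - exp Y‖ := by
    have := norm_sub_le ((exp X - exp Y) - (X - Y)) (exp X - exp Y)
    rw [sub_sub_cancel_left, norm_neg] at this
    linarith
  nlinarith [norm_nonneg (X - Y)]

end Banach

/-! ### The sharp bound on skew-Hermitian matrices (Frobenius norm) -/

section Skew

variable {N : ℕ}

/-- Powers of unitary matrices differ by at most `m` times the difference: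
`‖U^m − V^m‖_F ≤ m ‖U − V‖_F` (unitary invariance of the Frobenius norm). [folklore] -/
theorem norm_pow_sub_pow_le_of_unitary {U V : (Matrix (Fin N) (Fin N) ℂ)} (hU : U ∈ Matrix.unitaryGroup (Fin N) ℂ)
    (hV : V ∈ Matrix.unitaryGroup (Fin N) ℂ) (m : ℕ) : ‖U ^ m - V ^ m‖ ≤ m * ‖U - V‖ := by
  induction m with
  | zero => simp
  | succ m ih =>
    have hsplit : U ^ (m + 1) - V ^ (m + 1) = U * (U ^ m - V ^ m) + (U - V) * V ^ m := by
      simp only [pow_succ', mul_sub, sub_mul]; abel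
    have hVm : V ^ m ∈ Matrix.unitaryGroup (Fin N) ℂ := pow_mem hV m
    have h1 : ‖U * (U ^ m - V ^ m)‖ = ‖U ^ m - V ^ m‖ :=
      Matrix.frobenius_norm_unitaryGroup_mul ⟨U, hU⟩ _
    have h2 : ‖(U - V) * V ^ m‖ = ‖U - V‖ :=
      Matrix.frobenius_norm_mul_unitaryGroup _ ⟨V ^ m, hVm⟩
    calc ‖U ^ (m + 1) - V ^ (m + 1)‖ ≤ ‖U * (U ^ m - V ^ m)‖ + ‖(U - V) * V ^ m‖ := by
          rw [hsplit]; exact norm_add_le _ _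
      _ = ‖U ^ m - V ^ m‖ + ‖U - V‖ := by rw [h1, h2]
      _ ≤ m * ‖U - V‖ + ‖U - V‖ := by linarith [ih]
      _ = ((m + 1 : ℕ) : ℝ) * ‖U - V‖ := by push_cast; ring

/-- The exponential of a skew-Hermitian matrix is unitary. [folklore] -/
theorem exp_mem_unitaryGroup_of_skew {X : (Matrix (Fin N) (Fin N) ℂ)} (hX : Xᴴ = -X) :
    exp X ∈ Matrix.unitaryGroup (Fin N) ℂ :=
  exp_mem_unitary_of_mem_skewAdjoint (skewAdjoint.mem_iff.2 hX)

/-- A real multiple of a skew-Hermitian matrix is skew-Hermitian. [folklore] -/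
theorem conjTranspose_smul_of_skew {X : (Matrix (Fin N) (Fin N) ℂ)} (hX : Xᴴ = -X) (c : ℝ) : (c • X)ᴴ = -(c • X) := by
  rw [Matrix.conjTranspose_smul, hX, smul_neg, star_trivial]

/-- **The exponential map is `1`-Lipschitz on `𝔲(N)` in the Frobenius norm**: for skew-Hermitian
`X, Y`, `‖e^X − e^Y‖_F ≤ ‖X − Y‖_F`. Proof: `e^X = (e^{X/m})^m` with unitary `e^{X/m}`, so
`‖e^X − e^Y‖ ≤ m ‖e^{X/m} − e^{Y/m}‖ ≤ e^{r/m} ‖X − Y‖` for every `m ≥ 1` by the crude bound at radius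
`r/m`; let `m → ∞`. (This is the property of the Cayley chart, `UnitaryCayley.norm_chart_sub_chart_le`,
for the exponential chart.) [cite: arXiv160201222, Cor. 11.3 (the chart is Lipschitz)] -/
theorem norm_exp_sub_exp_le_of_skew {X Y : (Matrix (Fin N) (Fin N) ℂ)} (hX : Xᴴ = -X) (hY : Yᴴ = -Y) :
    ‖exp X - exp Y‖ ≤ ‖X - Y‖ := by
  set r : ℝ := max ‖X‖ ‖Y‖ with hr
  have hXr : ‖X‖ ≤ r := le_max_left _ _
  have hYr : ‖Y‖ ≤ r := le_max_right _ _
  have hr0 : 0 ≤ r := (norm_nonneg X).trans hXr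
  -- the bound for each `m ≥ 1`
  have hm : ∀ m : ℕ, ‖exp X - exp Y‖ ≤ Real.exp (r / (m + 1)) * ‖X - Y‖ := by
    intro m
    set c : ℝ := ((m + 1 : ℕ) : ℝ)⁻¹ with hc
    have hcpos : 0 < c := by rw [hc]; positivity
    have hcm : ((m + 1 : ℕ) : ℝ) * c = 1 := by rw [hc]; field_simp
    have hXc : (m + 1) • (c • X) = X := by
      rw [← Nat.cast_smul_eq_nsmul ℝ, smul_smul, hcm, one_smul]
    have hYc : (m + 1) • (c • Y) = Y := by
      rw [← Nat.cast_smul_eq_nsmul ℝ, smul_smul, hcm, one_smul]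
    -- (`exp_nsmul` is stated for the normed-ring instances; convert by definitional unfolding)
    have hA : exp (c • X) ^ (m + 1) = exp X := by
      have h := exp_nsmul (m + 1) (c • X)
      rw [hXc] at h
      exact h.symm
    have hB : exp (c • Y) ^ (m + 1) = exp Y := by
      have h := exp_nsmul (m + 1) (c • Y)
      rw [hYc] at h
      exact h.symm
    have hUA := exp_mem_unitaryGroup_of_skew (conjTranspose_smul_of_skew hX c)
    have hUB := exp_mem_unitaryGroup_of_skew (conjTranspose_smul_of_skew hY c)
    have h1 := norm_pow_sub_pow_le_of_unitary hUA hUB (m + 1)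
    have hnX : ‖c • X‖ ≤ c * r := by
      rw [norm_smul, Real.norm_of_nonneg hcpos.le]; exact mul_le_mul_of_nonneg_left hXr hcpos.le
    have hnY : ‖c • Y‖ ≤ c * r := by
      rw [norm_smul, Real.norm_of_nonneg hcpos.le]; exact mul_le_mul_of_nonneg_left hYr hcpos.le
    have h2 := norm_exp_sub_exp_le_exp_mul hnX hnY
    have hdiff : ‖c • X - c • Y‖ = c * ‖X - Y‖ := by
      rw [← smul_sub, norm_smul, Real.norm_of_nonneg hcpos.le]
    rw [hdiff] at h2
    have hcr : c * r = r / (m + 1) := by rw [hc]; push_cast; ring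
    calc ‖exp X - exp Y‖ = ‖exp (c • X) ^ (m + 1) - exp (c • Y) ^ (m + 1)‖ := by rw [hA, hB]
      _ ≤ ((m + 1 : ℕ) : ℝ) * ‖exp (c • X) - exp (c • Y)‖ := h1
      _ ≤ ((m + 1 : ℕ) : ℝ) * (Real.exp (c * r) * (c * ‖X - Y‖)) :=
          mul_le_mul_of_nonneg_left h2 (by positivity)
      _ = Real.exp (r / (m + 1)) * ‖X - Y‖ := by
          rw [hcr]
          have : ((m + 1 : ℕ) : ℝ) * (Real.exp (r / (m + 1)) * (c * ‖X - Y‖)) =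
              (((m + 1 : ℕ) : ℝ) * c) * (Real.exp (r / (m + 1)) * ‖X - Y‖) := by ring
          rw [this, hcm, one_mul]
  -- `m → ∞`
  have hlim : Tendsto (fun m : ℕ => Real.exp (r / (m + 1)) * ‖X - Y‖) atTop (𝓝 (Real.exp 0 * ‖X - Y‖)) := by
    refine ((Real.continuous_exp.tendsto 0).comp ?_).mul_const _
    have h := tendsto_const_div_atTop_nhds_zero_nat r
    exact (tendsto_add_atTop_iff_nat (f := fun n : ℕ => r / (n : ℝ)) 1).2 h |>.congr fun n => by
      push_cast; ring_nf
  rw [Real.exp_zero, one_mul] at hlim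
  exact ge_of_tendsto' hlim hm

/-- `‖e^X − 1‖_F ≤ ‖X‖_F` for skew-Hermitian `X`. [folklore] -/
theorem norm_exp_sub_one_le_of_skew {X : (Matrix (Fin N) (Fin N) ℂ)} (hX : Xᴴ = -X) : ‖exp X - 1‖ ≤ ‖X‖ := by
  have h := norm_exp_sub_exp_le_of_skew hX (Y := 0) (by simp)
  simpa using h

end Skew
-- BODY END

end Summit.QuantumFields.YangMills.Theorems.FreeEnergyLogCoefficient

end
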